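import Literature.Analysis.ODE.RecessiveDominanceSubBarrier
import Literature.Analysis.ODE.DiagonalKernelMaximum
import HarnessLib

/-!
# The two-point Green kernel across one deep barrier: far-side envelope, near-side growth, depth

Topic `Literature/Analysis/ODE` (namespace `Literature.Analysis.ODE`). The REAL equation `y″ = q(x) y`
on the line and two COMPLEX solutions `u` (think: the horizon-normalised solution of a radial wave
equation, entering a classically forbidden region `q ≥ 0` from the LEFT and growing through it) and `v`
(the infinity-normalised solution, entering from the RIGHT end `β` of the barrier with a flux
`Im(v̄ v′) ≡ F ≠ 0` and data `‖v′(β)‖ ≤ P₁`), with constant Wronskian `W = u v′ − v u′`. The Green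
kernel of the problem is `u(x)v(x′)/W` (`x ≤ x′`). This file proves the two-point bound
`‖u x‖·‖v x′‖ ≤ K·‖W‖` for all `x ≤ x′` with `x′` beyond a "collar" point `s_θ` of the barrier, from
four STRUCTURAL inputs and with an EXPLICIT `K`:

1. a floor `q ≥ k₀² > 0` on `[s_θ, β]` and a deep interior stretch `[s_lo, s_mid] ⊆ [s_θ, β]` with
   `q ≥ k₁²`, `8P₁² ≤ k₁|F| sinh(2k₁(s_mid − s_lo))` (DEPTH, cf. `RecessiveDominanceSubBarrier`);
2. quasi-monotone growth of `u` up to `β`: `‖u x‖ ≤ A‖u y‖` for `x ≤ y ∈ [s_θ, β]` (`A ≥ 1`), and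
   `Re(ū u′) ≥ 0` on `[s_θ, s_lo]` (outward growth at the deep points);
3. the far-side bound `‖u x‖‖v x′‖ ≤ K_A‖W‖` for `x ≤ x′`, `β ≤ x′` (in applications: the one-sided
   flux pairing `|F|‖u‖² ≤ ‖u‖‖v‖‖W‖` plus an envelope of `v` beyond `β`);
4. (implicit) continuity of `q` and global `HasDerivAt` data.

* `kernel_le_of_deep_point` — for `x ≤ α ∈ [s_θ, s_lo]`:
  `‖u x‖‖v α‖ ≤ A·(25/7)·(1 + k₀ℓ)/(k₀²ℓ)·‖W‖`, `ℓ = s_mid − s_lo` (recessive dominance of `v` at `α`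
  with the depth of the stretch and the `tanh` rate of the floor, growth pairing);
* `kernel_le_of_window_point` — for `x ≤ x′ ∈ [s_lo, β]`: the maximum principle for `‖u‖²‖v‖²` on
  `[s_lo, β]` (`DiagonalKernelMaximum.norm_sq_mul_norm_sq_le_max`, floor `k₀²`) with the two end values
  supplied by the deep-point bound at `s_lo` and the far-side bound at `β`;
* `oneBarrier_kernel_le` — all `x ≤ x′`, `s_θ ≤ x′`:
  `‖u x‖‖v x′‖ ≤ A·(A·(25/7)(1 + k₀ℓ)/(k₀²ℓ) + K_A + 1/(2k₀))·‖W‖`.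

This is the mechanism of the threshold (`ω = mω₊`) cone kernel bound in Breitenlohner–Freedman stable
sectors of the near-extremal Kerr programme (crux `KappaExplicitWaveDecay`), isolated from the Kerr
geometry: no flux pairing for `u`, no asymptotics, no special functions. All proved.

## References
* P. Hartman, *Ordinary Differential Equations* (SIAM Classics 38, 2002), Ch. XI §§2, 3, 6. Key
  `Hartman2002`.
* I. M. Gelfand, L. A. Dikii, Russian Math. Surveys 30:5 (1975) (diagonal resolvent kernel `ψ₊ψ₋/W`).
-/

noncomputable section

open Set
open scoped ComplexConjugate

namespace Literature.Analysis.ODE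

section OneBarrier

variable {q : ℝ → ℝ} {u u' v v' : ℝ → ℂ} {W : ℂ} {sθ slo smid β k₀ k₁ A KA F P₁ : ℝ}

/-- **Constancy of the Wronskian for global solutions** (two-point form of
`wronskian_complex_const`). [folklore] -/
theorem wronskian_eq_of_global_sol
    (hu : ∀ x, HasDerivAt u (u' x) x ∧ HasDerivAt u' ((q x : ℂ) * u x) x)
    (hv : ∀ x, HasDerivAt v (v' x) x ∧ HasDerivAt v' ((q x : ℂ) * v x) x) (x y : ℝ) :
    u x * v' x - v x * u' x = u y * v' y - v y * u' y := by
  rcases le_total x y with h | h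
  · exact (wronskian_complex_const (α := x) (β := y) (fun s _ ↦ hu s) (fun s _ ↦ hv s)
      (right_mem_Icc.2 h)).symm
  · exact wronskian_complex_const (α := y) (β := x) (fun s _ ↦ hu s) (fun s _ ↦ hv s)
      (right_mem_Icc.2 h)

/-- **Kernel at a deep point.** Floor `q ≥ k₀²` on `[s_θ, β]` (`k₀ > 0`), stretch
`[s_lo, s_mid] ⊆ [s_θ, β]` with `q ≥ k₁²` (`k₁ > 0`, `s_lo < s_mid`), `v` with `‖v′ β‖ ≤ P₁`,
`Im(v̄ v′)(β) = F` and depth `8P₁² ≤ k₁|F| sinh(2k₁(s_mid − s_lo))`, `u` quasi-monotone up to `β` with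
factor `A ≥ 1` and outward-growing on `[s_θ, s_lo]`, constant Wronskian `W`. Then for
`x ≤ α ∈ [s_θ, s_lo]`: `‖u x‖‖v α‖ ≤ A·(25/7)(1 + k₀ℓ)/(k₀²ℓ)·‖W‖`, `ℓ = s_mid − s_lo`. [folklore] -/
theorem kernel_le_of_deep_point (hq : Continuous q)
    (hv : ∀ x, HasDerivAt v (v' x) x ∧ HasDerivAt v' ((q x : ℂ) * v x) x)
    (hW : ∀ x, u x * v' x - v x * u' x = W)
    (hlomid : slo < smid) (hmidβ : smid ≤ β)
    (hk₀ : 0 < k₀) (hqk₀ : ∀ x ∈ Icc sθ β, k₀ ^ 2 ≤ q x)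
    (hk₁ : 0 < k₁) (hqk₁ : ∀ x ∈ Icc slo smid, k₁ ^ 2 ≤ q x)
    (hF : (conj (v β) * v' β).im = F) (hP₁ : ‖v' β‖ ≤ P₁)
    (hdeep : 8 * P₁ ^ 2 ≤ k₁ * |F| * Real.sinh (2 * (k₁ * (smid - slo))))
    (hA : 1 ≤ A) (hmono : ∀ x y, x ≤ y → sθ ≤ y → y ≤ β → ‖u x‖ ≤ A * ‖u y‖)
    (hgrow : ∀ y ∈ Icc sθ slo, 0 ≤ (conj (u y) * u' y).re)
    {x α : ℝ} (hxα : x ≤ α) (hα : α ∈ Icc sθ slo) :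
    ‖u x‖ * ‖v α‖ ≤
      A * (25 / 7 * ((1 + k₀ * (smid - slo)) / (k₀ ^ 2 * (smid - slo)))) * ‖W‖ := by
  set ℓ := smid - slo with hℓ
  have hℓ0 : 0 < ℓ := sub_pos.2 hlomid
  have hαlo : α ≤ slo := hα.2
  have hαβ : α ≤ β := hαlo.trans (hlomid.le.trans hmidβ)
  have hsub : Icc α β ⊆ Icc sθ β := Icc_subset_Icc_left hα.1
  -- recessive dominance of `v` at `α`
  have hdom := re_conj_mul_deriv_le_of_right_flux_subBarrier hq hαlo hlomid hmidβ hk₁ hk₀.le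
    (fun y hy ↦ hqk₀ y (hsub hy)) hqk₁ (fun y _ ↦ hv y) hF hP₁ hdeep
  -- the rate is at least `r₀ = (7/25) k₀²ℓ/(1 + k₀ℓ) > 0`
  set r := 7 / 25 * (k₀ * Real.tanh (k₀ * (β - α))) with hr
  set r₀ := 7 / 25 * (k₀ ^ 2 * ℓ / (1 + k₀ * ℓ)) with hr₀
  have hr₀pos : 0 < r₀ := by positivity
  have hr₀r : r₀ ≤ r := by
    have h := sq_mul_div_one_add_le_mul_tanh hk₀.le hℓ0.le
      (show ℓ ≤ β - α by rw [hℓ]; linarith)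
    rw [hr, hr₀]; linarith
  have hrpos : 0 < r := hr₀pos.trans_le hr₀r
  -- growth pairing
  have hA0 : 0 ≤ A := zero_le_one.trans hA
  have key := kernel_le_of_recessive_dominated_quasi (u := u) (u' := u') (v := v) (v' := v')
    hA0 hrpos.le (hmono x α hxα hα.1 hαβ) (hgrow α hα) (by rw [hr] at hdom ⊢; exact hdom)
  rw [hW α] at key
  -- `‖u x‖‖v α‖ ≤ A‖W‖/r ≤ A‖W‖/r₀`
  have h1 : ‖u x‖ * ‖v α‖ ≤ A * ‖W‖ / r := by
    rw [le_div_iff₀ hrpos, mul_comm]; exact key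
  have h2 : A * ‖W‖ / r ≤ A * ‖W‖ / r₀ :=
    div_le_div_of_nonneg_left (by positivity) hr₀pos hr₀r
  have e : A * ‖W‖ / r₀ = A * (25 / 7 * ((1 + k₀ * ℓ) / (k₀ ^ 2 * ℓ))) * ‖W‖ := by
    rw [hr₀]
    field_simp
  rw [← e]
  exact h1.trans h2

/-- **Kernel at a window point** (between the deep stretch and the end of the barrier). Hypotheses of
`kernel_le_of_deep_point`, plus the far-side bound `‖u x‖‖v x′‖ ≤ K_A‖W‖` for `x ≤ x′`, `β ≤ x′`
(`K_A ≥ 0`). Then for `x ≤ x′ ∈ [s_lo, β]`: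
`‖u x‖‖v x′‖ ≤ A·(A·(25/7)(1 + k₀ℓ)/(k₀²ℓ) + K_A + 1/(2k₀))·‖W‖` (maximum principle for `‖u‖²‖v‖²`
on `[s_lo, β]` with floor `k₀²`, end values from the deep point `s_lo` and the far side at `β`).
[folklore] -/
theorem kernel_le_of_window_point (hq : Continuous q)
    (hu : ∀ x, HasDerivAt u (u' x) x ∧ HasDerivAt u' ((q x : ℂ) * u x) x)
    (hv : ∀ x, HasDerivAt v (v' x) x ∧ HasDerivAt v' ((q x : ℂ) * v x) x)
    (hW : ∀ x, u x * v' x - v x * u' x = W)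
    (hθlo : sθ ≤ slo) (hlomid : slo < smid) (hmidβ : smid ≤ β)
    (hk₀ : 0 < k₀) (hqk₀ : ∀ x ∈ Icc sθ β, k₀ ^ 2 ≤ q x)
    (hk₁ : 0 < k₁) (hqk₁ : ∀ x ∈ Icc slo smid, k₁ ^ 2 ≤ q x)
    (hF : (conj (v β) * v' β).im = F) (hP₁ : ‖v' β‖ ≤ P₁)
    (hdeep : 8 * P₁ ^ 2 ≤ k₁ * |F| * Real.sinh (2 * (k₁ * (smid - slo))))
    (hA : 1 ≤ A) (hmono : ∀ x y, x ≤ y → sθ ≤ y → y ≤ β → ‖u x‖ ≤ A * ‖u y‖)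
    (hgrow : ∀ y ∈ Icc sθ slo, 0 ≤ (conj (u y) * u' y).re)
    (hKA : 0 ≤ KA) (hfar : ∀ x x', x ≤ x' → β ≤ x' → ‖u x‖ * ‖v x'‖ ≤ KA * ‖W‖)
    {x x' : ℝ} (hxx' : x ≤ x') (hx' : x' ∈ Icc slo β) :
    ‖u x‖ * ‖v x'‖ ≤
      A * (A * (25 / 7 * ((1 + k₀ * (smid - slo)) / (k₀ ^ 2 * (smid - slo)))) + KA +
        1 / (2 * k₀)) * ‖W‖ := by
  set ℓ := smid - slo with hℓ
  set KD := A * (25 / 7 * ((1 + k₀ * ℓ) / (k₀ ^ 2 * ℓ))) with hKD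
  have hℓ0 : 0 < ℓ := sub_pos.2 hlomid
  have hA0 : 0 ≤ A := zero_le_one.trans hA
  have hKD0 : 0 ≤ KD := by positivity
  have hloβ : slo ≤ β := hlomid.le.trans hmidβ
  have hW0 : 0 ≤ ‖W‖ := norm_nonneg _
  set S := KD + KA + 1 / (2 * k₀) with hS
  have hS0 : 0 ≤ S := by positivity
  -- end values
  have hlo : ‖u slo‖ * ‖v slo‖ ≤ KD * ‖W‖ :=
    kernel_le_of_deep_point hq hv hW hlomid hmidβ hk₀ hqk₀ hk₁ hqk₁ hF hP₁ hdeep hA hmono hgrow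
      le_rfl ⟨hθlo, le_rfl⟩
  have hβv : ‖u β‖ * ‖v β‖ ≤ KA * ‖W‖ := hfar β β le_rfl le_rfl
  -- maximum principle on `[s_lo, β]`
  have hmax := norm_sq_mul_norm_sq_le_max (a := slo) (b := β) (q₀ := k₀ ^ 2)
    (fun y _ ↦ hu y) (fun y _ ↦ hv y) (pow_pos hk₀ 2)
    (fun y hy ↦ hqk₀ y ⟨hθlo.trans hy.1.le, hy.2.le⟩) hx'
  rw [hW slo] at hmax
  -- each of the three candidates is at most `(S‖W‖)²`
  have hSW : ∀ {t : ℝ}, 0 ≤ t → t ≤ S → (t * ‖W‖) ^ 2 ≤ (S * ‖W‖) ^ 2 := fun ht htS ↦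
    pow_le_pow_left₀ (by positivity) (mul_le_mul_of_nonneg_right htS hW0) 2
  have c1 : ‖u slo‖ ^ 2 * ‖v slo‖ ^ 2 ≤ (S * ‖W‖) ^ 2 := by
    have h : (‖u slo‖ * ‖v slo‖) ^ 2 ≤ (KD * ‖W‖) ^ 2 := pow_le_pow_left₀ (by positivity) hlo 2
    rw [mul_pow] at h
    exact h.trans (hSW hKD0 (by rw [hS]; linarith [show 0 ≤ 1 / (2 * k₀) by positivity]))
  have c2 : ‖u β‖ ^ 2 * ‖v β‖ ^ 2 ≤ (S * ‖W‖) ^ 2 := by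
    have h : (‖u β‖ * ‖v β‖) ^ 2 ≤ (KA * ‖W‖) ^ 2 := pow_le_pow_left₀ (by positivity) hβv 2
    rw [mul_pow] at h
    exact h.trans (hSW hKA (by rw [hS]; linarith [show 0 ≤ 1 / (2 * k₀) by positivity]))
  have c3 : ‖W‖ ^ 2 / (4 * k₀ ^ 2) ≤ (S * ‖W‖) ^ 2 := by
    have e : ‖W‖ ^ 2 / (4 * k₀ ^ 2) = (1 / (2 * k₀) * ‖W‖) ^ 2 := by
      field_simp; ring
    rw [e]
    exact hSW (by positivity) (by rw [hS]; linarith)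
  have hsq : ‖u x'‖ ^ 2 * ‖v x'‖ ^ 2 ≤ (S * ‖W‖) ^ 2 :=
    hmax.trans (max_le c1 (max_le c2 c3))
  have hdiag : ‖u x'‖ * ‖v x'‖ ≤ S * ‖W‖ := by
    rw [← mul_pow] at hsq
    exact (pow_le_pow_iff_left₀ (by positivity) (by positivity) two_ne_zero).1 hsq
  -- quasi-monotonicity of `u` from `x` to `x′`
  have hm := hmono x x' hxx' (hθlo.trans hx'.1) hx'.2
  calc ‖u x‖ * ‖v x'‖ ≤ A * ‖u x'‖ * ‖v x'‖ := mul_le_mul_of_nonneg_right hm (norm_nonneg _)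
    _ = A * (‖u x'‖ * ‖v x'‖) := by ring
    _ ≤ A * (S * ‖W‖) := mul_le_mul_of_nonneg_left hdiag hA0
    _ = A * S * ‖W‖ := by ring

/-- **The two-point kernel bound across one deep barrier.** Under the hypotheses of
`kernel_le_of_window_point` (floor `k₀` on `[s_θ, β]`, deep stretch `[s_lo, s_mid]`, right data of
`v` at `β` with depth, quasi-monotone outward-growing `u`, far-side bound `K_A`), for ALL `x ≤ x′`
with `s_θ ≤ x′`:
`‖u x‖·‖v x′‖ ≤ A·(A·(25/7)(1 + k₀ℓ)/(k₀²ℓ) + K_A + 1/(2k₀))·‖W‖`, `ℓ = s_mid − s_lo`. [folklore] -/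
theorem oneBarrier_kernel_le (hq : Continuous q)
    (hu : ∀ x, HasDerivAt u (u' x) x ∧ HasDerivAt u' ((q x : ℂ) * u x) x)
    (hv : ∀ x, HasDerivAt v (v' x) x ∧ HasDerivAt v' ((q x : ℂ) * v x) x)
    (hW : ∀ x, u x * v' x - v x * u' x = W)
    (hθlo : sθ ≤ slo) (hlomid : slo < smid) (hmidβ : smid ≤ β)
    (hk₀ : 0 < k₀) (hqk₀ : ∀ x ∈ Icc sθ β, k₀ ^ 2 ≤ q x)
    (hk₁ : 0 < k₁) (hqk₁ : ∀ x ∈ Icc slo smid, k₁ ^ 2 ≤ q x)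
    (hF : (conj (v β) * v' β).im = F) (hP₁ : ‖v' β‖ ≤ P₁)
    (hdeep : 8 * P₁ ^ 2 ≤ k₁ * |F| * Real.sinh (2 * (k₁ * (smid - slo))))
    (hA : 1 ≤ A) (hmono : ∀ x y, x ≤ y → sθ ≤ y → y ≤ β → ‖u x‖ ≤ A * ‖u y‖)
    (hgrow : ∀ y ∈ Icc sθ slo, 0 ≤ (conj (u y) * u' y).re)
    (hKA : 0 ≤ KA) (hfar : ∀ x x', x ≤ x' → β ≤ x' → ‖u x‖ * ‖v x'‖ ≤ KA * ‖W‖)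
    {x x' : ℝ} (hxx' : x ≤ x') (hx' : sθ ≤ x') :
    ‖u x‖ * ‖v x'‖ ≤
      A * (A * (25 / 7 * ((1 + k₀ * (smid - slo)) / (k₀ ^ 2 * (smid - slo)))) + KA +
        1 / (2 * k₀)) * ‖W‖ := by
  set ℓ := smid - slo with hℓ
  set KD := A * (25 / 7 * ((1 + k₀ * ℓ) / (k₀ ^ 2 * ℓ))) with hKD
  have hℓ0 : 0 < ℓ := sub_pos.2 hlomid
  have hA0 : 0 ≤ A := zero_le_one.trans hA
  have hKD0 : 0 ≤ KD := by positivity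
  have hW0 : 0 ≤ ‖W‖ := norm_nonneg _
  have hk0i : 0 ≤ 1 / (2 * k₀) := by positivity
  -- the total constant dominates each case constant
  have hT : ∀ {t : ℝ}, t ≤ KD + KA + 1 / (2 * k₀) → t * ‖W‖ ≤ A * (KD + KA + 1 / (2 * k₀)) * ‖W‖ := by
    intro t ht
    have h1 : t ≤ A * (KD + KA + 1 / (2 * k₀)) := by
      have : KD + KA + 1 / (2 * k₀) ≤ A * (KD + KA + 1 / (2 * k₀)) :=
        le_mul_of_one_le_left (by positivity) hA
      exact ht.trans this
    exact mul_le_mul_of_nonneg_right h1 hW0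
  rcases le_or_gt x' slo with h1 | h1
  · -- deep point
    have h := kernel_le_of_deep_point hq hv hW hlomid hmidβ hk₀ hqk₀ hk₁ hqk₁ hF hP₁ hdeep hA hmono
      hgrow hxx' ⟨hx', h1⟩
    exact h.trans (hT (by linarith))
  rcases le_or_gt x' β with h2 | h2
  · -- window point
    exact kernel_le_of_window_point hq hu hv hW hθlo hlomid hmidβ hk₀ hqk₀ hk₁ hqk₁ hF hP₁ hdeep hA
      hmono hgrow hKA hfar hxx' ⟨h1.le, h2⟩
  · -- far side
    exact (hfar x x' hxx' h2.le).trans (hT (by linarith))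

end OneBarrier

end Literature.Analysis.ODE

end
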